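import Mathlib

/-!
# Rigid cores: the `StadiumAnalyticArea` conjunct is automatic (constant continuation)
# (`FilamentSkeletonRss`, live child crux `TangentSkeletonNearStraightL`, stmt-NavierStokesRegularity-23320, line
# `child_tangent_analytic_strip_L`, ∃-side of the registered stub `stub_analyticClosingL`; also the aside twin 28295)

In the A1L (rigid Lamb–Oseen core) variant the flat matrix `FlatJ1L` carries, instead of the area law, the RIGIDITY clause
`‖X j τ‖ ≤ 2Rb√(Γ log Γ) → Aa j τ = Aa j (c j)`: the core area is CONSTANT along the doubled ball.  The output `TangentSkeletonAnalyticL` of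
the line still asks for `StadiumAnalyticArea (cs√Γ) (Rb√(Γ log Γ)) (c j) (Aa j)` — an analytic continuation `G` of `Aa j` to the stadium
`{|Im z| < cs√Γ, |Re z − c j| < Rb√(Γ log Γ) + cs√Γ}` with the factor-two window.  Since the real shadow of that stadium lies inside the
doubled ball as soon as `Rw√Γ + Rb√(Γ log Γ) + cs√Γ ≤ 2Rb√(Γ log Γ)` (unit speed: `‖X j τ‖ ≤ ‖X j (c j)‖ + |τ − c j|`), the CONSTANT
function `G ≡ Aa j (c j)` is a witness.  This file records exactly that, in the line's letters (`Stadium`/`StadiumAnalyticArea` unfolded):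

* `norm_sub_le_of_unit_speed` — `‖X τ − X σ‖ ≤ |τ − σ|` for a differentiable unit-speed curve;
* `stadiumAnalyticArea_of_const` — a function constant (`= a > 0`) on the real shadow of the stadium is stadium-analytic there;
* `stadiumAnalyticArea_of_rigid_core` — the rigidity clause + `‖X c‖ ≤ Rw√Γ` + unit speed + the length inequality ⇒ the conjunct.

HONEST FRAMING: bookkeeping for a HYPOTHETICAL filament skeleton on the NEGATIVE side of a MODEL route; no registered stub is closed by this
file and nothing here bears on Navier–Stokes regularity or blow-up.  `--supports stmt-NavierStokesRegularity-23320`.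
-/

set_option linter.dupNamespace false

noncomputable section

namespace Summit.NavierStokesRegularity.NavierStokesRegularity.Theorems.StadiumRigidArea

open Set Metric Real

/-- A differentiable unit-speed curve is `1`-Lipschitz: `‖X τ − X σ‖ ≤ |τ − σ|`. [folklore] -/
theorem norm_sub_le_of_unit_speed {X : ℝ → EuclideanSpace ℝ (Fin 3)} (hX : Differentiable ℝ X)
    (hunit : ∀ τ, ‖deriv X τ‖ = 1) (τ σ : ℝ) : ‖X τ - X σ‖ ≤ |τ - σ| := by
  have h := (convex_univ (𝕜 := ℝ) (E := ℝ)).norm_image_sub_le_of_norm_deriv_le (f := X) (C := 1)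
    (fun x _ => hX x) (fun x _ => (hunit x).le) (mem_univ σ) (mem_univ τ)
  simpa [Real.norm_eq_abs] using h

/-- **A function constant on the real shadow of the stadium is stadium-analytic there** (witness: the constant), with the factor-two
window; `Stadium`/`StadiumAnalyticArea` of the line unfolded. [folklore] -/
theorem stadiumAnalyticArea_of_const {hs L cc a : ℝ} {A : ℝ → ℝ} (ha : 0 < a)
    (hA : ∀ x : ℝ, |x - cc| < L + hs → A x = a) :
    ∃ G : ℂ → ℂ, DifferentiableOn ℂ G {z : ℂ | |z.im| < hs ∧ |z.re - cc| < L + hs} ∧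
      (∀ t : ℝ, (t : ℂ) ∈ {z : ℂ | |z.im| < hs ∧ |z.re - cc| < L + hs} → G t = ((A t : ℝ) : ℂ)) ∧
      ∀ z ∈ {z : ℂ | |z.im| < hs ∧ |z.re - cc| < L + hs}, A z.re / 2 ≤ (G z).re ∧ ‖G z‖ ≤ 2 * A z.re := by
  refine ⟨fun _ => ((a : ℝ) : ℂ), differentiableOn_const _, ?_, ?_⟩
  · intro t ht
    have h := hA t (by simpa using ht.2)
    rw [h]
  · intro z hz
    have h := hA z.re hz.2
    rw [h]
    refine ⟨by simp; linarith, ?_⟩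
    rw [Complex.norm_real, Real.norm_eq_abs, abs_of_pos ha]
    linarith

/-- **Rigid cores make the `StadiumAnalyticArea` conjunct automatic.**  `X` differentiable with unit speed, `‖X c‖ ≤ Rw√Γ`; the core area
`Aa` is constant on the doubled ball, `‖X τ‖ ≤ 2Rb√(Γ log Γ) → Aa τ = Aa c`, with `Aa c > 0`; and the length inequality
`Rw√Γ + (Rb√(Γ log Γ) + cs√Γ) ≤ 2Rb√(Γ log Γ)` (true for `Γ` large at fixed `Rw, Rb, cs`).  Then
`StadiumAnalyticArea (cs√Γ) (Rb√(Γ log Γ)) c Aa` holds (unfolded), with the constant witness. [folklore] -/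
theorem stadiumAnalyticArea_of_rigid_core {Rw Rb cs Γ c : ℝ} {X : ℝ → EuclideanSpace ℝ (Fin 3)} {Aa : ℝ → ℝ}
    (hX : Differentiable ℝ X) (hunit : ∀ τ, ‖deriv X τ‖ = 1) (hXc : ‖X c‖ ≤ Rw * √Γ)
    (hrigid : ∀ τ, ‖X τ‖ ≤ 2 * Rb * √(Γ * Real.log Γ) → Aa τ = Aa c) (hpos : 0 < Aa c)
    (hlen : Rw * √Γ + (Rb * √(Γ * Real.log Γ) + cs * √Γ) ≤ 2 * Rb * √(Γ * Real.log Γ)) :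
    ∃ G : ℂ → ℂ, DifferentiableOn ℂ G {z : ℂ | |z.im| < cs * √Γ ∧ |z.re - c| < Rb * √(Γ * Real.log Γ) + cs * √Γ} ∧
      (∀ t : ℝ, (t : ℂ) ∈ {z : ℂ | |z.im| < cs * √Γ ∧ |z.re - c| < Rb * √(Γ * Real.log Γ) + cs * √Γ} →
        G t = ((Aa t : ℝ) : ℂ)) ∧
      ∀ z ∈ {z : ℂ | |z.im| < cs * √Γ ∧ |z.re - c| < Rb * √(Γ * Real.log Γ) + cs * √Γ},
        Aa z.re / 2 ≤ (G z).re ∧ ‖G z‖ ≤ 2 * Aa z.re := by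
  refine stadiumAnalyticArea_of_const hpos fun x hx => hrigid x ?_
  calc ‖X x‖ = ‖X c + (X x - X c)‖ := by rw [add_sub_cancel]
    _ ≤ ‖X c‖ + ‖X x - X c‖ := norm_add_le _ _
    _ ≤ Rw * √Γ + |x - c| := add_le_add hXc (norm_sub_le_of_unit_speed hX hunit x c)
    _ ≤ Rw * √Γ + (Rb * √(Γ * Real.log Γ) + cs * √Γ) := by linarith [hx.le]
    _ ≤ 2 * Rb * √(Γ * Real.log Γ) := hlen

end Summit.NavierStokesRegularity.NavierStokesRegularity.Theorems.StadiumRigidArea
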